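import Summits.QuantumFields.YangMills.Theorems.BalabanLadderNTSubsequentialBridge
import HarnessLib

/-!
# Crux `NT` (stmt-QuantumFields-19353): the summit is a statement about ONE TUNED SEQUENCE of bare couplings —
# sequence form of the whole leg hypothesis, and the typed-IR convenience form

Helper file (`--supports stmt-QuantumFields-19353`) of the fleet lead prover of crux `NT` (unit `ym-spine-19353-p1`, g29),
hypothesis-free; a reading aid for `…NTSubsequentialBridge`.  `Y2BridgeClay` §Seq recorded for the IR leg that a multiscale
engine delivers PER TUNED SEQUENCE `β_k → ∞` (`GapInUnitsSeq`) while the typed legs quantify over all large couplings.  With the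
subsequential bridge the same holds for the whole hypothesis:

* **`yangMills_of_legs_along_sequence`** — `YangMills ⇐ ∀ G simple ∃ r a (b : ℕ → ℝ), b_k → ∞ ∧ a > 0 ∧ a → 0 ∧ UV ∧ ROT ∧`
  «the `GapInUnits` family at the couplings `b_k`» `∧` «NT's two floors at each `b_k` on tori of unbounded size» (one positive-time
  `v`, one pairwise-disjoint triple `f, g, h`);
* `yangMills_of_subseqNT_typedIR` — the mixed form most likely to be used first: `UV`, `IR = GapInUnits`, `ROT` as typed in
  the route and ONLY `NT` weakened to its subsequential form on some cofinal set.

HONEST FRAMING: corollaries of `Y2Bridge.yangMills_of_subseqNTLegs` (`subseq_of_seq`, `gapOn_univ_of_gapInUnits`, `gapOn_mono`);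
every leg is a HYPOTHESIS; nothing about `NT`, the gap or Clay is proved. [folklore]
-/

set_option autoImplicit false

noncomputable section

open scoped SchwartzMap
open MeasureTheory Filter Topology Set
open Literature.MathematicalPhysics.QuantumFieldTheory Literature.MathematicalPhysics.QuantumLattice
open Literature.Probability.LatticeModels
open Summit.QuantumFields.YangMills.Cruxes.OSLegsFromFemtoAndGap.DlrCollarTransfer

namespace Summit.QuantumFields.YangMills.Cruxes.NT.Subsequential

/-- **The summit from the legs ALONG ONE TUNED SEQUENCE of bare couplings.**  For every compact simple `G`: SOME `r`, SOME
positive unit map `a → 0`, SOME sequence `b_k → ∞` such that `UV G r a`, `ROT G r a` (scheme-level statements), the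
`GapInUnits` clustering family holds at the couplings `b_k` (one rate, species-uniform constants, volume thresholds `S₁ (b k)`),
and NT's two floors hold at every `b_k` on tori of unbounded size — give `YangMills`. [folklore] -/
theorem yangMills_of_legs_along_sequence
    (hyp : ∀ (G : Type) [Group G] [TopologicalSpace G] [IsTopologicalGroup G] [CompactSpace G],
      IsCompactSimpleLieGroup G → letI : MeasurableSpace G := borel G; haveI : BorelSpace G := ⟨rfl⟩;
      ∃ (r : LatticeRep G) (a : ℝ → ℝ) (b : ℕ → ℝ), Tendsto b atTop atTop ∧ (∀ β, 0 < a β) ∧ Tendsto a atTop (𝓝 0) ∧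
        OSLegsAtWeakCouplingC.Y2Bridge.UV G r a ∧ OSLegsAtWeakCouplingC.Y2Bridge.ROT G r a ∧
        (∃ (c₁ : ℝ) (S₁ : ℝ → ℕ), 0 < c₁ ∧ ∀ A B : YMSpecies G, ∃ C : ℝ, ∀ k : ℕ,
          ∀ S n : ℕ, S₁ (b k) ≤ S → n ≤ S →
            |latticeConnectedCorr r.ρ (b k) (2 * S + 1) A.F B.F n| ≤ C * Real.exp (-(c₁ * a (b k) * n))) ∧
        (∃ (v : 𝓢(EuclideanSpace ℝ (Fin 4), ℝ)) (ε : ℝ) (f g h : 𝓢(EuclideanSpace ℝ (Fin 4), ℝ)) (ε' : ℝ),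
          tsupport (v : EuclideanSpace ℝ (Fin 4) → ℝ) ⊆ {y : EuclideanSpace ℝ (Fin 4) | 0 < y 0} ∧ 0 < ε ∧
          Disjoint (tsupport f) (tsupport g) ∧ Disjoint (tsupport g) (tsupport h) ∧
          Disjoint (tsupport f) (tsupport h) ∧ 0 < ε' ∧
          ∀ k : ℕ, ∀ D : ℕ, ∃ L : ℕ, D ≤ L ∧
            ε ≤ Q2 G r (b k) L (a (b k)) (thetaTest 4 v) v ∧ ε' ≤ |Q3 G r (b k) L (a (b k)) f g h|)) :
    YangMills := by
  refine OSLegsAtWeakCouplingC.Y2Bridge.yangMills_of_subseqNTLegs fun G _ _ _ _ hG => ?_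
  letI : MeasurableSpace G := borel G
  haveI : BorelSpace G := ⟨rfl⟩
  obtain ⟨r, a, b, hb, hapos, ha0, hUV, hROT, ⟨c₁, S₁, hc₁, hIR⟩, ⟨v, ε, f, g, h, ε', hv, hε, hfg, hgh, hfh, hε', hfl⟩⟩ :=
    hyp G hG
  refine ⟨r, a, hapos, ha0, hUV, hROT, Set.range b, ?_, ?_, ?_⟩
  · intro x
    obtain ⟨k, hk⟩ := (hb.eventually_ge_atTop x).exists
    exact ⟨b k, Set.mem_range_self k, hk⟩
  · refine ⟨c₁, 0, S₁, hc₁, fun A B => ?_⟩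
    obtain ⟨C, hC⟩ := hIR A B
    refine ⟨C, ?_⟩
    rintro β ⟨k, rfl⟩ - S n hS hn
    exact hC k S n hS hn
  · refine ⟨v, ε, f, g, h, ε', hv, hε, hfg, hgh, hfh, hε', ?_⟩
    rintro β ⟨k, rfl⟩ D
    exact hfl k D

/-- **The mixed form: typed `UV`, `IR`, `ROT` and the SUBSEQUENTIAL `NT`.**  For every compact simple `G`: SOME `r`, SOME positive
unit map `a → 0` with the typed legs `UV = MomentBounds6`, `IR = GapInUnits`, `ROT = LatticeRotWard`, and NT's two floors on
SOME cofinal set of couplings, at each on tori of unbounded size — give `YangMills`. [folklore] -/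
theorem yangMills_of_subseqNT_typedIR
    (hyp : ∀ (G : Type) [Group G] [TopologicalSpace G] [IsTopologicalGroup G] [CompactSpace G],
      IsCompactSimpleLieGroup G → letI : MeasurableSpace G := borel G; haveI : BorelSpace G := ⟨rfl⟩;
      ∃ (r : LatticeRep G) (a : ℝ → ℝ), (∀ β, 0 < a β) ∧ Tendsto a atTop (𝓝 0) ∧
        OSLegsAtWeakCouplingC.Y2Bridge.UV G r a ∧ OSLegsAtWeakCouplingC.Y2Bridge.IR G r a ∧
        OSLegsAtWeakCouplingC.Y2Bridge.ROT G r a ∧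
        ∃ Bset : Set ℝ, (∀ x : ℝ, ∃ β ∈ Bset, x ≤ β) ∧
          ∃ (v : 𝓢(EuclideanSpace ℝ (Fin 4), ℝ)) (ε : ℝ) (f g h : 𝓢(EuclideanSpace ℝ (Fin 4), ℝ)) (ε' : ℝ),
            tsupport (v : EuclideanSpace ℝ (Fin 4) → ℝ) ⊆ {y : EuclideanSpace ℝ (Fin 4) | 0 < y 0} ∧ 0 < ε ∧
            Disjoint (tsupport f) (tsupport g) ∧ Disjoint (tsupport g) (tsupport h) ∧
            Disjoint (tsupport f) (tsupport h) ∧ 0 < ε' ∧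
            ∀ β ∈ Bset, ∀ D : ℕ, ∃ L : ℕ, D ≤ L ∧
              ε ≤ Q2 G r β L (a β) (thetaTest 4 v) v ∧ ε' ≤ |Q3 G r β L (a β) f g h|) :
    YangMills := by
  refine OSLegsAtWeakCouplingC.Y2Bridge.yangMills_of_subseqNTLegs fun G _ _ _ _ hG => ?_
  letI : MeasurableSpace G := borel G
  haveI : BorelSpace G := ⟨rfl⟩
  obtain ⟨r, a, hapos, ha0, hUV, hIR, hROT, Bset, hBcof, hNT⟩ := hyp G hG
  exact ⟨r, a, hapos, ha0, hUV, hROT, Bset, hBcof,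
    OSLegsAtWeakCouplingC.Y2Bridge.gapOn_mono r a (Set.subset_univ _)
      (OSLegsAtWeakCouplingC.Y2Bridge.gapOn_univ_of_gapInUnits r a hIR), hNT⟩

end Summit.QuantumFields.YangMills.Cruxes.NT.Subsequential

end
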